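import Summits.Schanuel.Schanuel.Theorems.RootDecomp1ETwoScale06

/-!
# RootDecomp1ETwoScale — lens 2, generation 37 «TWO-SCALE E-PLANES» (items 25020 / 31409 of route 1E at n = 4 on `InTwoScaleClass`, mod NW96 Thm 1) — continuation (RootDecomp1ETwoScale07): §4 the two-level extraction `exists_int_relation₂` and the headlines (E3) `algebraicIndependent_two_scale (hNW)`, `algebraicIndependent_tower_sigma` (fact-free)

(lens-2 g37 `TwoScale.lean` v2 [HOME/decomp-schanuel-lens-2/g37/TwoScale.lean v2 sha256 e81e28b8…d084, 2853 l (v1 df3b5e32…, 2509 l + §5b); own farm rc 0 · 0 warn · 0 sorry · axioms std; critic VERDICT STATUS L1776 (credit E-R17, PORT GO), v2 ACK L1780]; port by census-1 gen 16 in nine parts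
`RootDecomp1ETwoScale01`–`09` — see the PORT NOTE of part 01; `--supports stmt-Schanuel-31409`; rung 0.)
-/

noncomputable section

open Complex Polynomial IntermediateField Filter

namespace Summit.Schanuel.Schanuel.Theorems.RootDecomp1ETwoScale

open Summit.Schanuel.Schanuel.Theorems.RootDecomp1KHyper
open Summit.Schanuel.Schanuel.Theorems.RootDecomp1KHyper.HyperCell
open Summit.Schanuel.Schanuel.Theorems.RootDecomp1KGeneric
open Literature.NumberTheory.Transcendental (NesterenkoWaldschmidt1996_thm_1 weilHeight₁)

variable {K : ℕ}

section Kernel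

/-- TWO-LEVEL EXTRACTION. An algebraic dependence of `(a, b, c)` with `(b, c)` algebraically
independent is witnessed by INTEGER polynomials: `Σ_j a^j · (Σ_k Gd_{j,k}(b) c^k) = 0` with some
`Gd_{j,k} ≠ 0`. -/
theorem exists_int_relation₂ {a b c : ℂ} (h : ¬ AlgebraicIndependent ℚ ![a, b, c])
    (hbc : AlgebraicIndependent ℚ ![b, c]) :
    ∃ (J K : ℕ) (Gd : Fin (J + 1) → Fin (K + 1) → ℤ[X]), (∃ j k, Gd j k ≠ 0) ∧
      ∑ j : Fin (J + 1), a ^ (j : ℕ) *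
        ∑ k : Fin (K + 1), aeval b (Gd j k) * c ^ (k : ℕ) = 0 := by
  classical
  -- Step 1: `a` is algebraic over `S := ℚ[x '' {0}ᶜ] ⊆ ℚ[b, c]`
  set x : Fin 3 → ℂ := ![a, b, c] with hx
  have h1 : AlgebraicIndependent ℚ (fun j : {j : Fin 3 // j ≠ 0} => x j) := by
    let f : {j : Fin 3 // j ≠ 0} → Fin 2 := fun j =>
      ⟨j.1.val - 1, by
        have h3 := j.1.2
        have h0 : j.1.val ≠ 0 := fun e => j.2 (Fin.ext e)
        omega⟩
    have hf : Function.Injective f := by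
      rintro ⟨⟨j, hj⟩, hj0⟩ ⟨⟨j', hj'⟩, hj0'⟩ hff
      have h0 : j ≠ 0 := fun e => hj0 (Fin.ext e)
      have h0' : j' ≠ 0 := fun e => hj0' (Fin.ext e)
      have hv : j - 1 = j' - 1 := by
        have := congrArg Fin.val hff
        simpa [f] using this
      apply Subtype.ext; apply Fin.ext
      show j = j'
      omega
    have e : (![b, c] : Fin 2 → ℂ) ∘ f = fun j : {j : Fin 3 // j ≠ 0} => x j := by
      funext ⟨⟨j, hj⟩, hj0⟩
      have h0 : j ≠ 0 := fun e => hj0 (Fin.ext e)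
      rcases (show j = 1 ∨ j = 2 by omega) with rfl | rfl <;> rfl
    rw [← e]
    exact hbc.comp f hf
  rw [AlgebraicIndependent.iff_transcendental_adjoin_image (0 : Fin 3)] at h
  set S := Algebra.adjoin ℚ (x '' {(0 : Fin 3)}ᶜ) with hS
  have halg : IsAlgebraic S (x 0) := by
    by_contra hna
    exact h ⟨h1, hna⟩
  have hx0 : x 0 = a := rfl
  have hsub : x '' {(0 : Fin 3)}ᶜ ⊆ ({b, c} : Set ℂ) := by
    rintro _ ⟨j, hj, rfl⟩
    have hj0 : j ≠ 0 := hj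
    have hjv : j.val ≠ 0 := fun e => hj0 (Fin.ext e)
    have hj3 := j.2
    rcases (show j.val = 1 ∨ j.val = 2 by omega) with hv | hv
    · have : j = 1 := Fin.ext hv
      subst this; exact Or.inl rfl
    · have : j = 2 := Fin.ext hv
      subst this; exact Or.inr rfl
  have hSle : S ≤ Algebra.adjoin ℚ ({b, c} : Set ℂ) := Algebra.adjoin_mono hsub
  obtain ⟨μ, hμ0, hμa⟩ := halg
  rw [hx0] at hμa
  set Jμ := μ.natDegree with hJμ
  -- Step 2: represent the coefficients of `μ` in `ℚ[b][c]`, uniformly in `k ≤ K`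
  have hrep : ∀ j : ℕ, ∃ K₀ : ℕ, ∀ K : ℕ, K₀ ≤ K → ∃ g : Fin (K + 1) → ℚ[X],
      ((μ.coeff j : S) : ℂ) = ∑ k : Fin (K + 1), aeval b (g k) * c ^ (k : ℕ) :=
    fun j => exists_rep_of_mem_adjoin_pair (hSle (μ.coeff j).2)
  choose K₀ hK₀ using hrep
  set K : ℕ := ∑ j ∈ Finset.range (Jμ + 1), K₀ j with hKdef
  have hKj : ∀ j : Fin (Jμ + 1), K₀ j ≤ K := fun j =>
    Finset.single_le_sum (f := K₀) (fun _ _ => Nat.zero_le _)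
      (Finset.mem_range.mpr j.2)
  choose g hg using fun j : Fin (Jμ + 1) => hK₀ j K (hKj j)
  -- Step 3: clear denominators with one common integer `N`
  have hnorm : ∀ (j : Fin (Jμ + 1)) (k : Fin (K + 1)), ∃ (G : ℤ[X]) (d : ℤ), d ≠ 0 ∧
      G.map (Int.castRingHom ℚ) = d • g j k := by
    intro j k
    obtain ⟨d, hd, hG⟩ := IsLocalization.integerNormalization_spec (nonZeroDivisors ℤ) (g j k)
    exact ⟨_, d, nonZeroDivisors.ne_zero hd, by simpa using hG⟩
  choose G₀ d hd0 hG₀ using hnorm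
  have haeval : ∀ j k, aeval b (G₀ j k) = (d j k : ℂ) * aeval b (g j k) := by
    intro j k
    have e1 : aeval b (G₀ j k) = aeval b ((G₀ j k).map (algebraMap ℤ ℚ)) := by
      rw [Polynomial.aeval_map_algebraMap]
    rw [e1, show algebraMap ℤ ℚ = Int.castRingHom ℚ from rfl, hG₀ j k, zsmul_eq_C_mul, map_mul,
      aeval_C]
    simp
  set N : ℤ := ∏ jk : Fin (Jμ + 1) × Fin (K + 1), d jk.1 jk.2 with hNdef
  have hN0 : N ≠ 0 := Finset.prod_ne_zero_iff.mpr fun jk _ => hd0 jk.1 jk.2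
  set Gd : Fin (Jμ + 1) → Fin (K + 1) → ℤ[X] := fun j k =>
    Polynomial.C (∏ jk ∈ Finset.univ.erase (j, k), d jk.1 jk.2) * G₀ j k with hGddef
  have hGd_aeval : ∀ j k, aeval b (Gd j k) = (N : ℂ) * aeval b (g j k) := by
    intro j k
    have hprod : (∏ jk ∈ Finset.univ.erase (j, k), d jk.1 jk.2) * d j k = N := by
      rw [hNdef]
      exact Finset.prod_erase_mul (f := fun jk : Fin (Jμ + 1) × Fin (K + 1) => d jk.1 jk.2)
        Finset.univ (Finset.mem_univ (j, k))
    rw [hGddef]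
    simp only [map_mul, eq_intCast, map_intCast]
    rw [haeval, ← mul_assoc, ← Int.cast_mul, hprod]
  have hblock : ∀ j : Fin (Jμ + 1), ∑ k : Fin (K + 1), aeval b (Gd j k) * c ^ (k : ℕ) =
      (N : ℂ) * ((μ.coeff j : S) : ℂ) := by
    intro j
    rw [hg j, Finset.mul_sum]
    exact Finset.sum_congr rfl fun k _ => by rw [hGd_aeval]; ring
  refine ⟨Jμ, K, Gd, ?_, ?_⟩
  · -- nontriviality from the leading coefficient of `μ`
    have hlead : ((μ.coeff Jμ : S) : ℂ) ≠ 0 := by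
      have : μ.coeff Jμ ≠ 0 := by
        rw [hJμ]; exact Polynomial.leadingCoeff_ne_zero.mpr hμ0
      exact fun e => this (by exact_mod_cast e)
    by_contra hall
    push Not at hall
    have h0 : ∑ k : Fin (K + 1), aeval b (Gd (Fin.last Jμ) k) * c ^ (k : ℕ) = 0 := by
      refine Finset.sum_eq_zero fun k _ => ?_
      rw [hall (Fin.last Jμ) k, map_zero, zero_mul]
    rw [hblock] at h0
    rcases mul_eq_zero.mp h0 with h2 | h2
    · exact hN0 (by exact_mod_cast h2)
    · exact hlead (by simpa using h2)
  · -- the relation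
    have hrel : aeval a μ = ∑ i ∈ Finset.range (Jμ + 1), ((μ.coeff i : S) : ℂ) * a ^ i := by
      rw [Polynomial.aeval_def, Polynomial.eval₂_eq_sum_range]
      rfl
    rw [hμa, ← Fin.sum_univ_eq_sum_range (fun i => ((μ.coeff i : S) : ℂ) * a ^ i) (Jμ + 1)]
      at hrel
    calc ∑ j : Fin (Jμ + 1), a ^ (j : ℕ) * ∑ k : Fin (K + 1), aeval b (Gd j k) * c ^ (k : ℕ)
        = (N : ℂ) * ∑ j : Fin (Jμ + 1), ((μ.coeff (j : ℕ) : S) : ℂ) * a ^ (j : ℕ) := by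
          rw [Finset.mul_sum]
          exact Finset.sum_congr rfl fun j _ => by rw [hblock]; ring
      _ = 0 := by rw [← hrel, mul_zero]

/-- THE KERNEL ONE LEVEL UP: a `FamMeasure` at every level (exponent `e ≥ 1`) for `(ρ, w)` and a
`LogPowLiouville (e + 1)` real `σ` make `(σ, ρ, w)` algebraically independent. -/
theorem algebraicIndependent_triple_of_famMeasure {ρ : ℝ} {w : ℂ} {e : ℕ} (he : 1 ≤ e)
    (hM : ∀ K, FamMeasure ρ w e K) {σ : ℝ} (hσ : LogPowLiouville (e + 1) σ) :
    AlgebraicIndependent ℚ ![(σ : ℂ), (ρ : ℂ), w] := by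
  by_contra hdep
  obtain ⟨J, K', Gd, hGd, hrel⟩ :=
    exists_int_relation₂ hdep (algebraicIndependent_pair_of_famMeasure hM)
  exact kernel_sum_ne_zero he (hM K') hσ Gd hGd hrel

/-- (E3) THE TWO-SCALE THEOREM. For every covered tower `T ≠ 0` and every `LogPowLiouville 19`
real `σ`: `σ, T, e^T` are algebraically independent (modulo NW96 Thm 1, used only in (E2)). -/
theorem algebraicIndependent_two_scale (hNW : NesterenkoWaldschmidt1996_thm_1) {T σ : ℝ}
    (hT : CoveredTower T) (hT0 : T ≠ 0) (hσ : LogPowLiouville 19 σ) :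
    AlgebraicIndependent ℚ ![(σ : ℂ), (T : ℂ), cexp T] :=
  algebraicIndependent_triple_of_famMeasure (e := 18) (by norm_num)
    (fun K' => famMeasure_tower (K := K') (Or.inr hNW) hT hT0) hσ

/-- HYPOTHESIS-FREE companion: a covered tower `T ≠ 0` and a `LogPowLiouville 19` real `σ` are
algebraically independent (the kernel at level `0`; no transcendence fact is used). -/
theorem algebraicIndependent_tower_sigma {T σ : ℝ} (hT : CoveredTower T) (hT0 : T ≠ 0)
    (hσ : LogPowLiouville 19 σ) : AlgebraicIndependent ℚ ![(T : ℂ), (σ : ℂ)] :=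
  algebraicIndependent_sigma_of_famMeasure (e := 18) (by norm_num)
    (famMeasure_tower (K := 0) (Or.inl rfl) hT hT0) hσ

end Kernel

end Summit.Schanuel.Schanuel.Theorems.RootDecomp1ETwoScale
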